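/-
Copyright: the b2b-balaban T⁴-continuum CRUX team, leaf lineage `t4-ne7b-formalise-leaf-04` (gen 162). Project licence.
-/
import Summits.QuantumFields.BalabanUV.T4Continuum.Spine.NE7b.LocalNemytskiiSup

/-!
# LOCAL INTERACTIONS WITH LETTERS ON THE SUP BALL ONLY: the Nemytskii map `φ ↦ u ∘ φ` on `ℓ^∞(ι)` is `C¹` on the open
# sup ball `‖φ‖_∞ < ρ` with `‖DN(φ)‖ ≤ λ(ρ)` and `‖DN(φ) − DN(ψ)‖ ≤ L(ρ)·‖φ − ψ‖_∞` on the closed ball, as soon as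
# `|u′| ≤ λ` and `Lip u′ ≤ L` hold for field values `|t| ≤ ρ` — and the small-field background configuration of
# (58) `…LocalNemytskiiSup` follows for every radius `r < ρ` with `c = ‖P‖·λ(ρ)`
# (row NE7b, node U5c; (58) §3∕§6 + HSCR `exists_branch_chart` + HSBD BY NAME; Mathlib otherwise; [folklore])

Cell `pub-balaban`, sub-cell `t4`, spine estimate NE7b (`T4WeightBudget.RelWeightBound`; the cell's OWN estimate — NOT PRINTED
in [Bałaban 1983–89], NOT PROVED).  Crux-route work under `Spine/NE7b/` by leaf lineage `t4-ne7b-formalise-leaf-04` (gen 162) under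
FREEZE (0)'s crux-prover clause (FILING-CLAIM C-ne7bleaf04g162-3), typing the object the row OWNER (`t4-ne7b-p1` gen 114) listed as
«in reach, not typed»: (58) with letters on the ball.  NOTHING of Bałaban's is named as a Lean object, valued or asserted; no
`T4Continuum/Support` leaf typed; no `def`, no notation; zero `sorry`.  Imports (58) `…LocalNemytskiiSup` only (HSCR ∕ HSBD and
Mathlib's `lp` behind it).  `ι` is ANY index type; `E := lp (fun _ : ι => ℝ) ∞` in prose.

WHY (located).  (58) `exists_nemytskii` ∕ `exists_smallField_branch(_deriv)` ask for `|u′| ≤ λ` and `|u′ s − u′ t| ≤ L|s − t|` on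
ALL of `ℝ`.  A sitewise term read through a chart of a compact fibre (`1 − cos`, or any real-analytic local action) has such
letters only for bounded field values, with `λ = λ(ρ)`, `L = L(ρ)` growing with the field radius `ρ`; and after ONE step the next
equation map `Q ∘ Eq ∘ σ` lives on a ball anyway.  Print's small-field regions are sup balls, so the natural shape of the
small-field letter is LOCAL IN THE SUP NORM: hypotheses on `u` for `|t| ≤ ρ`, conclusions for configurations in the sup ball of
radius `ρ`.  The proofs are (58)'s, with the segment `[φ(i), φ(i) + h(i)]` kept inside `[−ρ, ρ]`.

WHAT IS PROVED ([folklore]):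
* §1 `abs_add_le_of_mem_uIcc` (the segment stays in the ball), **`abs_taylor_two_of_abs_le`** (`|a| ≤ ρ`, `|a + b| ≤ ρ`, `u′`
  `L`-Lipschitz on `[−ρ, ρ]` ⟹ `|u(a + b) − u(a) − u′(a)b| ≤ L·b²`), `exists_bound_comp_of_hasDerivAt` (`u ∘ φ` is bounded for
  every bounded `φ` when `u` is differentiable everywhere — continuity on `[−‖φ‖, ‖φ‖]`).
* §2 **`exists_nemytskii_ball`** — `u` differentiable everywhere, `|u′ t| ≤ λ` and `|u′ s − u′ t| ≤ L|s − t|` for `|s|, |t| ≤ ρ`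
  ⟹ `∃ N : E → E, N′ : E → (E →L E)` with `N φ i = u(φ i)` for EVERY `φ`, and on the ball: `N′ φ h i = u′(φ i)·h i` and
  `‖N′ φ‖ ≤ λ` for `‖φ‖ ≤ ρ`, **`HasFDerivAt N (N′ φ) φ` for `‖φ‖ < ρ`**, **`‖N′ φ − N′ ψ‖ ≤ L·‖φ − ψ‖` for `‖φ‖, ‖ψ‖ ≤ ρ`**.
* §3 **`exists_eqMap_letters_ball`** — the EQUATION-MAP letters on `closedBall 0 r`, `r < ρ`, for `Eq φ := A φ + N φ`
  (`A : E →L E` any bounded linear part): `Eq 0 = 0` (when `u 0 = 0`), `HasFDerivAt Eq (A + N′ x) x`, `‖N′ x‖ ≤ λ`,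
  `‖A + N′ x‖ ≤ ‖A‖ + λ`, `‖(A + N′ x) − (A + N′ x′)‖ ≤ L‖x − x′‖` — the shape an inductive step in equation-map form consumes;
  `norm_comp_add_sub_le` (`‖P ∘ ((A + M) − A)‖ ≤ ‖P‖·λ` for `‖M‖ ≤ λ`: its smallness hypothesis with `c = ‖P‖·λ(ρ)`).
* §4 **`exists_smallField_branch_ball`** — (58) §4∕§6 with the local letters: `ι` nonempty; chart `T : E ≃L F × K`,
  `T h = (Q h, R h)`, `‖T⁻¹ y‖ ≤ N‖y‖`; `‖P‖ ≤ C_P`; `u 0 = 0`; `C_P·λ ≤ c < N⁻¹`; radius `0 ≤ r < ρ` ⟹ a branch `σ : F → E`,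
  `σ 0 = 0`, with, for `‖w‖ ≤ (N⁻¹ − c)r`: `‖σ w‖ ≤ r`, `Q(σ w) = w`, `R(σ w) + P(N(σ w)) = 0`; `(N⁻¹ − c)⁻¹`-Lipschitz there;
  uniqueness in the `r`-ball; for `‖w‖ < (N⁻¹ − c)r`: `σ` differentiable, `‖Dσ(w)‖ ≤ (N⁻¹ − c)⁻¹`, `Q ∘ Dσ(w) = 1`; and —
  with `N′` exported — THE INTERACTING CHART AT THE BACKGROUND `A(w) h = (Q h, R h + P(N′(σ w) h))`, `‖A(w)⁻¹‖ ≤ (N⁻¹ − c)⁻¹`,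
  `Dσ(w) = A(w)⁻¹ ∘ inl` (the local twin of the OWNER's (61) `…SupInteractingChart`)
  (HSCR `exists_branch_chart` at `δ₀ = 0`, HSBD `hasFDerivAt_sliceBranch_of_chart` ∕ `fst_comp_symm_comp_inl`, (58)
  `hasFDerivAt_transversal` ∕ `norm_fderiv_transversal_sub_le` ∕ `norm_linearisation_sub_le` ∕ `nontrivial_lp_infty` BY NAME).
* §5 toy.

NOT HERE (honest): the chart `T` ((56) abstract; ASE for the Gaussian skeleton on `ℤ^d`); the values `λ(ρ)`, `L(ρ)` for any
concrete `u`; base points other than `0`; gauge-covariant actions ((A3), NC-NE7b-α UNRULED); anything of Bałaban's.  BY-NAME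
EFFECT ON THE WALL: NONE.  NE7b NOT PRINTED ∕ NOT PROVED; spine PROVED 0∕9; rung (B)+1 on a FINITE torus — NOT infinite volume,
NOT the mass gap, NOT Clay.  HONEST DEPENDENCY: continuum YM on T⁴ ⇐ BetaPertH ∧ nine spine estimates (0∕9 proved); BetaPertH ⇐
(D1) ∧ (D4) ∧ CAP+tail; G-an2-4 gates asym, D1 and NE2∕3∕4.
-/

set_option autoImplicit false

noncomputable section

namespace Summit.QuantumFields.BalabanUV.T4Continuum.NE7b.LocalNemytskiiSupBall

open Set Metric Filter Topology Asymptotics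
open scoped ENNReal NNReal
open Summit.QuantumFields.BalabanUV.T4Continuum.NE7b.LocalNemytskiiSup
  (abs_apply_le_norm exists_clm_mul hasFDerivAt_transversal norm_fderiv_transversal_sub_le nontrivial_lp_infty
    norm_linearisation_sub_le)

variable {ι : Type*}

/-! ## §1. Sitewise letters on a bounded field range -/

/-- The segment `a + uIcc 0 b` stays in `[−ρ, ρ]` when its endpoints do: `|a| ≤ ρ`, `|a + b| ≤ ρ`, `t ∈ uIcc 0 b` ⟹
`|a + t| ≤ ρ`. [folklore] -/
theorem abs_add_le_of_mem_uIcc {ρ a b t : ℝ} (ha : |a| ≤ ρ) (hab : |a + b| ≤ ρ) (ht : t ∈ uIcc (0 : ℝ) b) :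
    |a + t| ≤ ρ := by
  rw [abs_le] at ha hab ⊢
  rcases le_total 0 b with hb | hb
  · rw [uIcc_of_le hb] at ht
    constructor <;> linarith [ht.1, ht.2]
  · rw [uIcc_of_ge hb] at ht
    constructor <;> linarith [ht.1, ht.2]

/-- **SECOND-ORDER TAYLOR WITH A LOCAL LIPSCHITZ LETTER**: if `u` has derivative `u′` everywhere and `u′` is `L`-Lipschitz on
`[−ρ, ρ]`, then for `|a| ≤ ρ`, `|a + b| ≤ ρ`: `|u(a + b) − u(a) − u′(a)·b| ≤ L·b²` (mean-value inequality for
`t ↦ u(a + t) − u′(a)·t` on the segment, which stays in the ball by `abs_add_le_of_mem_uIcc`). [folklore] -/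
theorem abs_taylor_two_of_abs_le {u u' : ℝ → ℝ} (hu : ∀ t, HasDerivAt u (u' t) t) {ρ L : ℝ} (hL0 : 0 ≤ L)
    (hL : ∀ s t, |s| ≤ ρ → |t| ≤ ρ → |u' s - u' t| ≤ L * |s - t|) {a b : ℝ} (ha : |a| ≤ ρ) (hab : |a + b| ≤ ρ) :
    |u (a + b) - u a - u' a * b| ≤ L * b ^ 2 := by
  have hderiv : ∀ t ∈ uIcc (0 : ℝ) b,
      HasDerivWithinAt (fun t => u (a + t) - u' a * t) (u' (a + t) - u' a) (uIcc (0 : ℝ) b) t := by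
    intro t _
    have h1 : HasDerivAt (fun t => u (a + t)) (u' (a + t)) t := HasDerivAt.comp_const_add a t (hu (a + t))
    have h2 : HasDerivAt (fun t => u' a * t) (u' a) t := by
      simpa using (hasDerivAt_id t).const_mul (u' a)
    exact (h1.sub h2).hasDerivWithinAt
  have hbound : ∀ t ∈ uIcc (0 : ℝ) b, ‖u' (a + t) - u' a‖ ≤ L * |b| := by
    intro t ht
    rw [Real.norm_eq_abs]
    have h1 := hL (a + t) a (abs_add_le_of_mem_uIcc ha hab ht) ha
    rw [add_sub_cancel_left] at h1
    have ht' : |t| ≤ |b| := by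
      rcases le_total 0 b with hb | hb
      · rw [uIcc_of_le hb] at ht
        rw [abs_of_nonneg ht.1, abs_of_nonneg hb]; exact ht.2
      · rw [uIcc_of_ge hb] at ht
        rw [abs_of_nonpos ht.2, abs_of_nonpos hb]; linarith [ht.1]
    exact h1.trans (mul_le_mul_of_nonneg_left ht' hL0)
  have h := Convex.norm_image_sub_le_of_norm_hasDerivWithin_le hderiv hbound (convex_uIcc 0 b) left_mem_uIcc right_mem_uIcc
  simp only [add_zero, mul_zero, sub_zero, Real.norm_eq_abs] at h
  calc |u (a + b) - u a - u' a * b| = |u (a + b) - u' a * b - u a| := by ring_nf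
    _ ≤ L * |b| * |b| := h
    _ = L * b ^ 2 := by rw [mul_assoc, abs_mul_abs_self, sq]

/-- **A DIFFERENTIABLE `u` MAPS BOUNDED FIELDS TO BOUNDED FIELDS**: for `φ ∈ ℓ^∞(ι)` there is `C` with `|u(φ i)| ≤ C` for all `i`
(`u` is continuous, `[−‖φ‖, ‖φ‖]` is compact). [folklore] -/
theorem exists_bound_comp_of_hasDerivAt {u u' : ℝ → ℝ} (hu : ∀ t, HasDerivAt u (u' t) t) (φ : lp (fun _ : ι => ℝ) ∞) :
    ∃ C : ℝ, ∀ i, |u (φ i)| ≤ C := by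
  have hcont : Continuous u := continuous_iff_continuousAt.2 fun t => (hu t).continuousAt
  obtain ⟨C, hC⟩ := (isCompact_Icc (a := -‖φ‖) (b := ‖φ‖)).exists_bound_of_continuousOn hcont.continuousOn
  refine ⟨C, fun i => ?_⟩
  have hi : φ i ∈ Icc (-‖φ‖) ‖φ‖ := by
    have := abs_apply_le_norm φ i
    rw [abs_le] at this
    exact this
  have := hC (φ i) hi
  rwa [Real.norm_eq_abs] at this

/-! ## §2. The Nemytskii map with letters on the sup ball -/

/-- **THE NEMYTSKII MAP ON `ℓ^∞` WITH LETTERS ON THE SUP BALL.**  `u : ℝ → ℝ` with derivative `u′` everywhere, `|u′ t| ≤ λ` for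
`|t| ≤ ρ` and `|u′ s − u′ t| ≤ L|s − t|` for `|s|, |t| ≤ ρ` ⟹ there are `N : ℓ^∞ → ℓ^∞` and `N′ : ℓ^∞ → (ℓ^∞ →L ℓ^∞)` with
`N φ i = u (φ i)` for every `φ`; for `‖φ‖ ≤ ρ`: `N′ φ h i = u′(φ i)·h i` and `‖N′ φ‖ ≤ λ`; for `‖φ‖ < ρ`: `HasFDerivAt N (N′ φ) φ`;
and for `‖φ‖, ‖ψ‖ ≤ ρ`: `‖N′ φ − N′ ψ‖ ≤ L·‖φ − ψ‖`.  (Outside the closed ball `N′` is unspecified.) [folklore] -/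
theorem exists_nemytskii_ball {u u' : ℝ → ℝ} (hu : ∀ t, HasDerivAt u (u' t) t) {ρ lam L : ℝ} (hlam0 : 0 ≤ lam)
    (hlam : ∀ t, |t| ≤ ρ → |u' t| ≤ lam) (hL0 : 0 ≤ L) (hL : ∀ s t, |s| ≤ ρ → |t| ≤ ρ → |u' s - u' t| ≤ L * |s - t|) :
    ∃ (N : lp (fun _ : ι => ℝ) ∞ → lp (fun _ : ι => ℝ) ∞)
      (N' : lp (fun _ : ι => ℝ) ∞ → (lp (fun _ : ι => ℝ) ∞ →L[ℝ] lp (fun _ : ι => ℝ) ∞)),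
      (∀ (φ : lp (fun _ : ι => ℝ) ∞) (i : ι), N φ i = u (φ i)) ∧
      (∀ φ ∈ closedBall (0 : lp (fun _ : ι => ℝ) ∞) ρ, ∀ (h : lp (fun _ : ι => ℝ) ∞) (i : ι), N' φ h i = u' (φ i) * h i) ∧
      (∀ φ ∈ closedBall (0 : lp (fun _ : ι => ℝ) ∞) ρ, ‖N' φ‖ ≤ lam) ∧
      (∀ φ ∈ ball (0 : lp (fun _ : ι => ℝ) ∞) ρ, HasFDerivAt N (N' φ) φ) ∧
      (∀ φ ∈ closedBall (0 : lp (fun _ : ι => ℝ) ∞) ρ, ∀ ψ ∈ closedBall (0 : lp (fun _ : ι => ℝ) ∞) ρ,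
        ‖N' φ - N' ψ‖ ≤ L * ‖φ - ψ‖) := by
  -- sup-ball membership, sitewise
  have hsite : ∀ φ : lp (fun _ : ι => ℝ) ∞, ‖φ‖ ≤ ρ → ∀ i, |φ i| ≤ ρ := fun φ hφ i => (abs_apply_le_norm φ i).trans hφ
  have hmemBall : ∀ {φ : lp (fun _ : ι => ℝ) ∞}, φ ∈ closedBall (0 : lp (fun _ : ι => ℝ) ∞) ρ → ‖φ‖ ≤ ρ := fun hφ => by
    rwa [mem_closedBall, dist_zero_right] at hφ
  -- the map
  have hmem : ∀ φ : lp (fun _ : ι => ℝ) ∞, Memℓp (fun i => u (φ i)) ∞ := fun φ => by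
    obtain ⟨C, hC⟩ := exists_bound_comp_of_hasDerivAt (ι := ι) hu φ
    exact memℓp_infty ⟨C, by
      rintro _ ⟨i, rfl⟩
      dsimp only
      rw [Real.norm_eq_abs]
      exact hC i⟩
  obtain ⟨N, hN⟩ : ∃ N : lp (fun _ : ι => ℝ) ∞ → lp (fun _ : ι => ℝ) ∞, ∀ φ i, N φ i = u (φ i) :=
    ⟨fun φ => ⟨fun i => u (φ i), hmem φ⟩, fun φ i => rfl⟩
  -- the derivative family: multiplication by `u′ ∘ φ` on the ball (and anything, here `0`, outside)
  have key : ∀ φ : lp (fun _ : ι => ℝ) ∞, ∃ M : lp (fun _ : ι => ℝ) ∞ →L[ℝ] lp (fun _ : ι => ℝ) ∞,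
      ‖φ‖ ≤ ρ → (∀ (h : lp (fun _ : ι => ℝ) ∞) (i : ι), M h i = u' (φ i) * h i) ∧ ‖M‖ ≤ lam := by
    intro φ
    by_cases hφ : ‖φ‖ ≤ ρ
    · obtain ⟨M, hM, hMn⟩ := exists_clm_mul (fun i => u' (φ i)) hlam0 (fun i => hlam (φ i) (hsite φ hφ i))
      exact ⟨M, fun _ => ⟨hM, hMn⟩⟩
    · exact ⟨0, fun h => absurd h hφ⟩
  choose N' hN' using key
  refine ⟨N, N', hN, fun φ hφ => (hN' φ (hmemBall hφ)).1, fun φ hφ => (hN' φ (hmemBall hφ)).2, fun φ hφ => ?_,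
    fun φ hφ ψ hψ => ?_⟩
  · -- differentiability at an interior point: the remainder is `≤ L‖h‖²` once `‖h‖ ≤ ρ − ‖φ‖`
    rw [mem_ball, dist_zero_right] at hφ
    have hφ' : ‖φ‖ ≤ ρ := hφ.le
    have hrem : ∀ h : lp (fun _ : ι => ℝ) ∞, ‖h‖ ≤ ρ - ‖φ‖ → ‖N (φ + h) - N φ - N' φ h‖ ≤ L * ‖h‖ ^ 2 := fun h hh =>
      lp.norm_le_of_forall_le (by positivity) fun i => by
        rw [lp.coeFn_sub, lp.coeFn_sub, Pi.sub_apply, Pi.sub_apply, hN, hN, (hN' φ hφ').1, lp.coeFn_add, Pi.add_apply,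
          Real.norm_eq_abs]
        have hab : |φ i + h i| ≤ ρ := by
          have h1 : |φ i + h i| ≤ ‖φ + h‖ := by
            have := abs_apply_le_norm (φ + h) i
            rwa [lp.coeFn_add, Pi.add_apply] at this
          exact h1.trans ((norm_add_le φ h).trans (by linarith))
        exact (abs_taylor_two_of_abs_le hu hL0 hL (hsite φ hφ' i) hab).trans
          (mul_le_mul_of_nonneg_left (by
            rw [← sq_abs]
            exact pow_le_pow_left₀ (abs_nonneg _) (abs_apply_le_norm h i) 2) hL0)
    rw [hasFDerivAt_iff_isLittleO_nhds_zero, isLittleO_iff]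
    intro ε hε
    have hδ : 0 < min (ε / (L + 1)) (ρ - ‖φ‖) := lt_min (div_pos hε (by linarith)) (by linarith)
    filter_upwards [Metric.ball_mem_nhds (0 : lp (fun _ : ι => ℝ) ∞) hδ] with h hh
    rw [Metric.mem_ball, dist_zero_right, lt_min_iff] at hh
    calc ‖N (φ + h) - N φ - N' φ h‖ ≤ L * ‖h‖ ^ 2 := hrem h hh.2.le
      _ = (L * ‖h‖) * ‖h‖ := by ring
      _ ≤ ((L + 1) * (ε / (L + 1))) * ‖h‖ :=
          mul_le_mul_of_nonneg_right (mul_le_mul (by linarith) hh.1.le (norm_nonneg _) (by linarith)) (norm_nonneg _)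
      _ = ε * ‖h‖ := by rw [mul_div_cancel₀ _ (by linarith : (L + 1 : ℝ) ≠ 0)]
  · -- the Lipschitz letter for the derivative on the closed ball
    have hφ' : ‖φ‖ ≤ ρ := hmemBall hφ
    have hψ' : ‖ψ‖ ≤ ρ := hmemBall hψ
    refine ContinuousLinearMap.opNorm_le_bound _ (mul_nonneg hL0 (norm_nonneg _)) fun h => ?_
    refine lp.norm_le_of_forall_le (mul_nonneg (mul_nonneg hL0 (norm_nonneg _)) (norm_nonneg _)) fun i => ?_
    rw [sub_apply, lp.coeFn_sub, Pi.sub_apply, (hN' φ hφ').1, (hN' ψ hψ').1, ← sub_mul,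
      Real.norm_eq_abs, abs_mul]
    have h1 : |u' (φ i) - u' (ψ i)| ≤ L * ‖φ - ψ‖ :=
      (hL (φ i) (ψ i) (hsite φ hφ' i) (hsite ψ hψ' i)).trans (mul_le_mul_of_nonneg_left (by
        have := abs_apply_le_norm (φ - ψ) i
        rwa [lp.coeFn_sub, Pi.sub_apply] at this) hL0)
    exact mul_le_mul h1 (abs_apply_le_norm h i) (abs_nonneg _) (mul_nonneg hL0 (norm_nonneg _))

/-! ## §3. The equation-map letters on a closed ball `r < ρ` -/

/-- **THE EQUATION-MAP LETTERS ON THE BALL.**  Under §2's hypotheses and `u 0 = 0`, for any bounded linear part `A : ℓ^∞ →L ℓ^∞`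
and any radius `r < ρ`, the equation map `Eq φ := A φ + u ∘ φ` satisfies: `Eq 0 = 0`; at every `x ∈ closedBall 0 r`,
`HasFDerivAt Eq (A + N′ x) x` with `‖N′ x‖ ≤ λ` (so `‖P ∘ (Eq′ x − A)‖ ≤ ‖P‖·λ` for any fibre projection `P`, see
`norm_comp_add_sub_le`) and `‖A + N′ x‖ ≤ ‖A‖ + λ`; and `‖(A + N′ x) − (A + N′ x′)‖ ≤ L‖x − x′‖` on that ball — the data an
inductive step in equation-map form consumes, from LOCAL letters of `u`. [folklore] -/
theorem exists_eqMap_letters_ball {u u' : ℝ → ℝ} (hu : ∀ t, HasDerivAt u (u' t) t) (hu0 : u 0 = 0) {ρ lam L : ℝ}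
    (hlam0 : 0 ≤ lam) (hlam : ∀ t, |t| ≤ ρ → |u' t| ≤ lam) (hL0 : 0 ≤ L)
    (hL : ∀ s t, |s| ≤ ρ → |t| ≤ ρ → |u' s - u' t| ≤ L * |s - t|)
    (A : lp (fun _ : ι => ℝ) ∞ →L[ℝ] lp (fun _ : ι => ℝ) ∞) {r : ℝ} (hrρ : r < ρ) :
    ∃ (N : lp (fun _ : ι => ℝ) ∞ → lp (fun _ : ι => ℝ) ∞)
      (N' : lp (fun _ : ι => ℝ) ∞ → (lp (fun _ : ι => ℝ) ∞ →L[ℝ] lp (fun _ : ι => ℝ) ∞)),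
      (∀ (φ : lp (fun _ : ι => ℝ) ∞) (i : ι), N φ i = u (φ i)) ∧
      A 0 + N 0 = 0 ∧
      (∀ x ∈ closedBall (0 : lp (fun _ : ι => ℝ) ∞) r, HasFDerivAt (fun φ => A φ + N φ) (A + N' x) x) ∧
      (∀ x ∈ closedBall (0 : lp (fun _ : ι => ℝ) ∞) r, ‖N' x‖ ≤ lam) ∧
      (∀ x ∈ closedBall (0 : lp (fun _ : ι => ℝ) ∞) r, ‖A + N' x‖ ≤ ‖A‖ + lam) ∧
      (∀ x ∈ closedBall (0 : lp (fun _ : ι => ℝ) ∞) r, ∀ x' ∈ closedBall (0 : lp (fun _ : ι => ℝ) ∞) r,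
        ‖(A + N' x) - (A + N' x')‖ ≤ L * ‖x - x'‖) := by
  obtain ⟨N, N', hN, -, hN'norm, hNderiv, hN'lip⟩ := exists_nemytskii_ball (ι := ι) hu hlam0 hlam hL0 hL
  have hsub : closedBall (0 : lp (fun _ : ι => ℝ) ∞) r ⊆ ball (0 : lp (fun _ : ι => ℝ) ∞) ρ :=
    closedBall_subset_ball hrρ
  have hsub' : closedBall (0 : lp (fun _ : ι => ℝ) ∞) r ⊆ closedBall (0 : lp (fun _ : ι => ℝ) ∞) ρ :=
    closedBall_subset_closedBall hrρ.le
  have hN0 : N 0 = 0 := lp.ext (funext fun i => by rw [hN, lp.coeFn_zero, Pi.zero_apply, hu0])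
  refine ⟨N, N', hN, by rw [hN0, map_zero, add_zero], fun x hx => A.hasFDerivAt.add (hNderiv x (hsub hx)),
    fun x hx => hN'norm x (hsub' hx),
    fun x hx => (norm_add_le _ _).trans (add_le_add le_rfl (hN'norm x (hsub' hx))), fun x hx x' hx' => ?_⟩
  rw [add_sub_add_left_eq_sub]
  exact hN'lip x (hsub' hx) x' (hsub' hx')

/-- **THE SMALLNESS LETTER's INPUT**: for the equation map's derivative `A + M` with `‖M‖ ≤ λ` and ANY bounded `P` into any
normed space, `‖P ∘ ((A + M) − A)‖ ≤ ‖P‖·λ` — the shape `‖P ∘ (Eq′ x − A)‖ ≤ c` of the inductive step's smallness hypothesis, with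
`c = ‖P‖·λ(ρ)`. [folklore] -/
theorem norm_comp_add_sub_le {K : Type*} [NormedAddCommGroup K] [NormedSpace ℝ K]
    (P : lp (fun _ : ι => ℝ) ∞ →L[ℝ] K) (A M : lp (fun _ : ι => ℝ) ∞ →L[ℝ] lp (fun _ : ι => ℝ) ∞) {lam : ℝ}
    (hM : ‖M‖ ≤ lam) : ‖P.comp ((A + M) - A)‖ ≤ ‖P‖ * lam := by
  rw [add_sub_cancel_left]
  exact (ContinuousLinearMap.opNorm_comp_le _ _).trans (mul_le_mul_of_nonneg_left hM (norm_nonneg _))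

/-! ## §4. The small-field background configuration from local letters -/

section Branch

variable {F K : Type*} [NormedAddCommGroup F] [NormedSpace ℝ F] [NormedAddCommGroup K] [NormedSpace ℝ K]

/-- **THE SMALL-FIELD BACKGROUND CONFIGURATION FROM LETTERS ON THE SUP BALL.**  `ι` nonempty; a chart `T : ℓ^∞ ≃L F × K` reading
`(Q, R)` (`T h = (Q h, R h)`) with `‖T⁻¹ y‖ ≤ N‖y‖`; a projection `P : ℓ^∞ →L K` with `‖P‖ ≤ C_P`; a sitewise term `u`,
differentiable everywhere, with `u 0 = 0`, `|u′ t| ≤ λ` for `|t| ≤ ρ` and `u′` `L`-Lipschitz on `[−ρ, ρ]`; smallness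
`C_P·λ ≤ c < N⁻¹`; a radius `0 ≤ r < ρ`.  Then there is a branch `σ : F → ℓ^∞` with `σ 0 = 0` such that for all
`w ∈ closedBall 0 ((N⁻¹ − c)·r)`: `σ w ∈ closedBall 0 r`, `Q (σ w) = w`, `R (σ w) + P (u ∘ σ w) = 0`; `σ` is `(N⁻¹ − c)⁻¹`-Lipschitz
there; every `φ ∈ closedBall 0 r` solving the equation is `σ (Q φ)`; at every interior `‖w‖ < (N⁻¹ − c)·r` the branch is differentiable with
`‖Dσ(w)‖ ≤ (N⁻¹ − c)⁻¹` and `Q ∘ Dσ(w) = 1`; and, exported with the Nemytskii derivative family `N′` (formula on the `ρ`-ball,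
`HasFDerivAt N (N′φ) φ` on the open `ρ`-ball), THE INTERACTING CHART AT THE BACKGROUND: an `A : ℓ^∞ ≃L F × K` with
`A h = (Q h, R h + P (N′(σ w) h))`, `‖A⁻¹ z‖ ≤ (N⁻¹ − c)⁻¹‖z‖`, `HasFDerivAt σ (A⁻¹ ∘ inl) w` (the local twin of the OWNER's (61)
`…SupInteractingChart`).  HSCR `exists_branch_chart` at `δ₀ = 0` and HSBD `hasFDerivAt_sliceBranch_of_chart`, fed with §2's local
letters on `closedBall 0 r ⊆ ball 0 ρ`. [folklore] -/
theorem exists_smallField_branch_ball [Nonempty ι] (Q : lp (fun _ : ι => ℝ) ∞ →L[ℝ] F) (R P : lp (fun _ : ι => ℝ) ∞ →L[ℝ] K)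
    (T : lp (fun _ : ι => ℝ) ∞ ≃L[ℝ] F × K) (hT : ∀ h, T h = (Q h, R h)) {N c CP lam : ℝ≥0}
    (hN : ∀ y : F × K, ‖T.symm y‖ ≤ N * ‖y‖) (hP : ‖P‖ ≤ CP) (hc : CP * lam ≤ c) (hcN : c < N⁻¹)
    {u u' : ℝ → ℝ} (hu : ∀ t, HasDerivAt u (u' t) t) (hu0 : u 0 = 0) {ρ : ℝ} (hlam : ∀ t, |t| ≤ ρ → |u' t| ≤ lam)
    {L : ℝ} (hL0 : 0 ≤ L) (hL : ∀ s t, |s| ≤ ρ → |t| ≤ ρ → |u' s - u' t| ≤ L * |s - t|) {r : ℝ} (hr : 0 ≤ r)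
    (hrρ : r < ρ) :
    ∃ (Nu : lp (fun _ : ι => ℝ) ∞ → lp (fun _ : ι => ℝ) ∞)
      (N' : lp (fun _ : ι => ℝ) ∞ → (lp (fun _ : ι => ℝ) ∞ →L[ℝ] lp (fun _ : ι => ℝ) ∞)) (σ : F → lp (fun _ : ι => ℝ) ∞),
      (∀ (φ : lp (fun _ : ι => ℝ) ∞) (i : ι), Nu φ i = u (φ i)) ∧
      (∀ φ ∈ closedBall (0 : lp (fun _ : ι => ℝ) ∞) ρ, ∀ (h : lp (fun _ : ι => ℝ) ∞) (i : ι), N' φ h i = u' (φ i) * h i) ∧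
      (∀ φ ∈ ball (0 : lp (fun _ : ι => ℝ) ∞) ρ, HasFDerivAt Nu (N' φ) φ) ∧ σ 0 = 0 ∧
      (∀ w ∈ closedBall (0 : F) (((N : ℝ)⁻¹ - c) * r),
        σ w ∈ closedBall 0 r ∧ Q (σ w) = w ∧ R (σ w) + P (Nu (σ w)) = 0) ∧
      LipschitzOnWith (N⁻¹ - c)⁻¹ σ (closedBall (0 : F) (((N : ℝ)⁻¹ - c) * r)) ∧
      (∀ φ ∈ closedBall (0 : lp (fun _ : ι => ℝ) ∞) r, R φ + P (Nu φ) = 0 → σ (Q φ) = φ) ∧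
      (∀ w ∈ ball (0 : F) (((N : ℝ)⁻¹ - c) * r),
        DifferentiableAt ℝ σ w ∧ ‖fderiv ℝ σ w‖ ≤ ((N : ℝ)⁻¹ - c)⁻¹ ∧ Q.comp (fderiv ℝ σ w) = ContinuousLinearMap.id ℝ F) ∧
      (∀ w ∈ ball (0 : F) (((N : ℝ)⁻¹ - c) * r), ∃ A : lp (fun _ : ι => ℝ) ∞ ≃L[ℝ] F × K,
        (∀ h, A h = (Q h, R h + P (N' (σ w) h))) ∧
        (∀ z : F × K, ‖A.symm z‖ ≤ ((N : ℝ)⁻¹ - c)⁻¹ * ‖z‖) ∧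
        HasFDerivAt σ ((A.symm : F × K →L[ℝ] lp (fun _ : ι => ℝ) ∞).comp (ContinuousLinearMap.inl ℝ F K)) w) := by
  haveI : Nontrivial (lp (fun _ : ι => ℝ) ∞) := nontrivial_lp_infty
  obtain ⟨Nu, N', hNapp, hN'app, hN'norm, hNderiv, -⟩ :=
    exists_nemytskii_ball (ι := ι) hu lam.coe_nonneg hlam hL0 hL
  have hsub : closedBall (0 : lp (fun _ : ι => ℝ) ∞) r ⊆ ball (0 : lp (fun _ : ι => ℝ) ∞) ρ :=
    closedBall_subset_ball hrρ
  have hsub' : closedBall (0 : lp (fun _ : ι => ℝ) ∞) r ⊆ closedBall (0 : lp (fun _ : ι => ℝ) ∞) ρ :=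
    closedBall_subset_closedBall hrρ.le
  have hN0 : Nu 0 = 0 := lp.ext (funext fun i => by rw [hNapp, lp.coeFn_zero, Pi.zero_apply, hu0])
  have hg0 : R 0 + P (Nu 0) = 0 := by rw [hN0, map_zero, map_zero, add_zero]
  have hc' : ∀ x ∈ closedBall (0 : lp (fun _ : ι => ℝ) ∞) r, ‖P‖ * ‖N' x‖ ≤ c := fun x hx =>
    (mul_le_mul hP (hN'norm x (hsub' hx)) (norm_nonneg _) CP.coe_nonneg).trans (by exact_mod_cast hc)
  have hgd : ∀ x ∈ closedBall (0 : lp (fun _ : ι => ℝ) ∞) r, DifferentiableAt ℝ (fun ψ => R ψ + P (Nu ψ)) x :=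
    fun x hx => (hasFDerivAt_transversal R P (hNderiv x (hsub hx))).differentiableAt
  have hgc : ∀ x ∈ closedBall (0 : lp (fun _ : ι => ℝ) ∞) r, ‖fderiv ℝ (fun ψ => R ψ + P (Nu ψ)) x - R‖ ≤ c := fun x hx =>
    (norm_fderiv_transversal_sub_le R P (hNderiv x (hsub hx)) le_rfl).trans (hc' x hx)
  obtain ⟨σ, hσ0, hσ, hlip, huniq⟩ :=
    HardStepChartRadius.exists_branch_chart Q R T hT (δ₀ := 0) hr hN hcN hgd hgc
  rw [map_zero] at hσ0 hσ hlip
  -- HSBD's letters for `Φ = (Q, R + P∘Nu)`, `Φ′ = (Q, R + P∘N′)` on the `r`-ball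
  have hΦd : ∀ x ∈ closedBall (0 : lp (fun _ : ι => ℝ) ∞) r,
      HasFDerivAt (fun ψ => (Q ψ, R ψ + P (Nu ψ))) (Q.prod (R + P.comp (N' x))) x := fun x hx =>
    Q.hasFDerivAt.prodMk (hasFDerivAt_transversal R P (hNderiv x (hsub hx)))
  have hΦc : ∀ x ∈ closedBall (0 : lp (fun _ : ι => ℝ) ∞) r,
      ‖Q.prod (R + P.comp (N' x)) - (T : lp (fun _ : ι => ℝ) ∞ →L[ℝ] F × K)‖ ≤ c := fun x hx =>
    (norm_linearisation_sub_le Q R P T hT le_rfl).trans (hc' x hx)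
  have hσ' : ∀ w ∈ closedBall (0 : F) (((N : ℝ)⁻¹ - c) * r), σ w ∈ closedBall 0 r ∧
      ((fun ψ => (Q ψ, R ψ + P (Nu ψ))) (σ w)).1 = w ∧ ((fun ψ => (Q ψ, R ψ + P (Nu ψ))) (σ w)).2 = 0 := fun w hw => by
    obtain ⟨h1, h2, h3⟩ := hσ w hw
    refine ⟨h1, h2, ?_⟩
    show R (σ w) + P (Nu (σ w)) = 0
    rw [h3, hg0]
  refine ⟨Nu, N', σ, hNapp, hN'app, hNderiv, hσ0, fun w hw => ?_, hlip, fun φ hφ hEL => huniq φ hφ (by rw [hEL, hg0]),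
    fun w hw => ?_, fun w hw => ?_⟩
  · obtain ⟨h1, h2, h3⟩ := hσ w hw
    exact ⟨h1, h2, by rw [h3, hg0]⟩
  · obtain ⟨A, hAeq, -, hd, hn⟩ := HardStepBranchDeriv.hasFDerivAt_sliceBranch_of_chart T hN hcN hΦd hΦc hσ'
      hlip.continuousOn hw
    have hA : ∀ h, A h = (Q h, (R + P.comp (N' (σ w))) h) := fun h => by
      rw [← ContinuousLinearEquiv.coe_coe, hAeq, ContinuousLinearMap.prod_apply]
    refine ⟨hd.differentiableAt, by rwa [hd.fderiv], ?_⟩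
    rw [hd.fderiv]
    exact HardStepBranchDeriv.fst_comp_symm_comp_inl A Q _ hA
  · -- the interacting chart at the background `σ w`, exported (the local twin of the OWNER's (61))
    obtain ⟨A, hAeq, hAinv, hd, -⟩ := HardStepBranchDeriv.hasFDerivAt_sliceBranch_of_chart T hN hcN hΦd hΦc hσ'
      hlip.continuousOn hw
    refine ⟨A, fun h => ?_, hAinv, hd⟩
    rw [← ContinuousLinearEquiv.coe_coe, hAeq, ContinuousLinearMap.prod_apply, add_apply,
      ContinuousLinearMap.comp_apply]

end Branch

/-! ## §5. Toy -/

/-- Toy: the segment letter at `ρ = 1`, `a = 1∕2`, `b = −1`, `t = −1∕2` (`t ∈ uIcc 0 (−1)`): `|1∕2 + (−1∕2)| ≤ 1`. -/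
example : |(1 / 2 : ℝ) + (-1 / 2)| ≤ 1 := by norm_num

end Summit.QuantumFields.BalabanUV.T4Continuum.NE7b.LocalNemytskiiSupBall

end
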